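import Literature.Probability.RandomPlanarGeometry.EllipseHulls
import HarnessLib

/-!
# Stub `stub_ellipseHullFamily` of line `pin-the-shear` (crux stmt-CriticalPhenomena-14221,
# `Theses.SAWPhaseRetrieval.HexTransfer`)

Four elementary facts about the tree's half-ellipse hulls `B(a,b;ρ) = ellHull a b ρ`
(`EllipseHulls`: foci `a < b`, centre `c = ellC a b = (a+b)/2`, scale `h = ellH a b = (b-a)/4`,
parameter `ρ ∈ (0, 1)`, restriction derivative `Φ_B'(0) = ellDeriv a b ρ`), which the line lead
uses to exclude an axis-stretch covariance of the chordal SLE(8/3) laws: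

1. **axis form** (`ellHull_eq_axis`): `B(a,b;ρ)` is the closed upper half of the ellipse with
   centre `c`, horizontal semi-axis `h(ρ + ρ⁻¹)` and vertical semi-axis `h(ρ⁻¹ - ρ)`. The core is
   the classical equivalence, for the confocal family with foci `±2`,
   `‖u - 2‖ + ‖u + 2‖ ≤ 2L ↔ (re u / L)² + (im u / M)² ≤ 1` (`M² = L² - 4`, `focalSum_le_iff_axis`),
   proved without square roots: every point lies ON the confocal ellipse of its own focal sum `S`
   (the polynomial identity `4x²(S² - 16) + 4y²S² = S²(S² - 16)`), and the quadratic forms of the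
   family are monotone in the level (`axis_core`).
2. **confocal room** (`exists_thickening_ellHull_subset`): for `r < ρ` the hull `B(a,b;r)`
   contains the `θ`-neighbourhood of `B(a,b;ρ)` in `ℍ̄`, `θ = h((r + r⁻¹) - (ρ + ρ⁻¹))`, because the
   focal sum is `2`-Lipschitz (`focalSum_le_add`).
3. **strict derivative bound** (`ellDeriv_lt_one`): `Φ_B'(0) < 1` under the positivity condition
   `h(ρ + ρ⁻¹) < c`, from `-ρ < v₀ < 0` (`ellNode_data`) and `ρ < 1`.
4. **flattening** (`tendsto_ellDeriv_flattening`): for the hulls centred at `1` with foci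
   `1 ∓ √(α² - β²)` and parameter `√((α - β)/(α + β))`, `Φ'(0) → 1` as `β → 0⁺`: the whole
   expression is continuous in `β` at `β = 0` (the node `v₀ = J⁻¹(toNorm 0)` depends continuously
   on the foci through the holomorphic inverse branch `jInv`, `differentiableAt_jInv`), where it
   takes the value `ellDeriv (1 - α) (1 + α) 1 = 1` (`ellDeriv_one`).

* `stub_ellipseHullFamily` : the registered stub, verbatim (the conjunction of 1–4).
-/

noncomputable section

namespace Summit.CriticalPhenomena.SAWScalingLimit.Cruxes.HexTransfer.PinTheShear

open MeasureTheory Filter Topology Set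
open scoped NNReal ENNReal
open Literature.Probability.RandomPlanarGeometry

/-! ### 1. The axis form of the confocal ellipses -/

/-- `‖u + 2‖² = (re u + 2)² + (im u)²`. [folklore] -/
theorem norm_add_two_sq (u : ℂ) : ‖u + 2‖ ^ 2 = (u.re + 2) ^ 2 + u.im ^ 2 := by
  rw [Complex.sq_norm, Complex.normSq_apply]
  simp only [Complex.add_re, Complex.add_im, Complex.re_ofNat, Complex.im_ofNat]
  ring

/-- `‖u - 2‖² = (re u - 2)² + (im u)²`. [folklore] -/
theorem norm_sub_two_sq (u : ℂ) : ‖u - 2‖ ^ 2 = (u.re - 2) ^ 2 + u.im ^ 2 := by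
  rw [Complex.sq_norm, Complex.normSq_apply]
  simp only [Complex.sub_re, Complex.sub_im, Complex.re_ofNat, Complex.im_ofNat]
  ring

/-- **Algebraic core of the axis form.** For the distances `d₁, d₂ ≥ 0` of `(x, y)` to the foci
`∓2` (so `|d₁ - d₂| ≤ 4`) and a level `L > 2`:
`d₂ + d₁ ≤ 2L ↔ x²(L² - 4) + L²y² ≤ L²(L² - 4)`. With `S = d₁ + d₂` one has the identity
`4x²(S² - 16) + 4y²S² = S²(S² - 16)` (the point lies on the confocal ellipse of level `S/2`), and
`G(t) = 4x²(t - 16) + 4y²t - t(t - 16)` satisfies `G(T²) - G(S²) = (T² - S²)(4x² + 4y² + 16 - T² - S²)`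
with `4x² + 4y² + 16 = S² + (d₁ - d₂)² ∈ [S², 2S²]`; both directions follow (`T = 2L > 4`). [folklore] -/
theorem axis_core {d₁ d₂ x y L : ℝ} (h1 : 0 ≤ d₁) (h2 : 0 ≤ d₂)
    (hd1 : d₁ ^ 2 = (x + 2) ^ 2 + y ^ 2) (hd2 : d₂ ^ 2 = (x - 2) ^ 2 + y ^ 2)
    (hdd : (d₁ - d₂) ^ 2 ≤ 16) (hL : 2 < L) :
    d₂ + d₁ ≤ 2 * L ↔ x ^ 2 * (L ^ 2 - 4) + L ^ 2 * y ^ 2 ≤ L ^ 2 * (L ^ 2 - 4) := by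
  have hL0 : 0 < L := by linarith
  -- the point lies on the confocal ellipse of its own focal sum `S = d₁ + d₂`
  have hGS : 4 * x ^ 2 * ((d₁ + d₂) ^ 2 - 16) + 4 * y ^ 2 * (d₁ + d₂) ^ 2 -
      (d₁ + d₂) ^ 2 * ((d₁ + d₂) ^ 2 - 16) = 0 := by
    linear_combination (-2 * (d₁ + d₂) ^ 2 + (d₁ ^ 2 - d₂ ^ 2 + 8 * x)) * hd1 +
      (-2 * (d₁ + d₂) ^ 2 - (d₁ ^ 2 - d₂ ^ 2 + 8 * x)) * hd2
  constructor
  · intro h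
    have hTS : 0 ≤ (2 * L) ^ 2 - (d₁ + d₂) ^ 2 := by
      have := mul_nonneg (sub_nonneg.2 h) (by linarith : (0 : ℝ) ≤ 2 * L + (d₂ + d₁))
      nlinarith [this]
    have hQ : 4 * x ^ 2 + 4 * y ^ 2 + 16 ≤ 2 * (d₁ + d₂) ^ 2 := by
      nlinarith [mul_nonneg h1 h2, hd1, hd2]
    have hprod : 0 ≤ ((2 * L) ^ 2 - (d₁ + d₂) ^ 2) *
        ((2 * L) ^ 2 + (d₁ + d₂) ^ 2 - 4 * x ^ 2 - 4 * y ^ 2 - 16) :=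
      mul_nonneg hTS (by nlinarith [hQ, hTS])
    have key : 16 * (x ^ 2 * (L ^ 2 - 4) + L ^ 2 * y ^ 2 - L ^ 2 * (L ^ 2 - 4)) =
        (4 * x ^ 2 * ((d₁ + d₂) ^ 2 - 16) + 4 * y ^ 2 * (d₁ + d₂) ^ 2 -
          (d₁ + d₂) ^ 2 * ((d₁ + d₂) ^ 2 - 16)) -
        ((2 * L) ^ 2 - (d₁ + d₂) ^ 2) *
          ((2 * L) ^ 2 + (d₁ + d₂) ^ 2 - 4 * x ^ 2 - 4 * y ^ 2 - 16) := by
      ring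
    nlinarith [key, hGS, hprod]
  · intro h
    by_contra hlt
    push Not at hlt
    have hTS : (2 * L) ^ 2 < (d₁ + d₂) ^ 2 := by
      have := mul_pos (sub_pos.2 hlt) (by linarith : (0 : ℝ) < 2 * L + (d₂ + d₁))
      nlinarith [this]
    have hL4 : 16 < (2 * L) ^ 2 := by nlinarith
    have hQ : 4 * x ^ 2 + 4 * y ^ 2 + 16 = (d₁ + d₂) ^ 2 + (d₁ - d₂) ^ 2 := by
      linear_combination (-2) * hd1 + (-2) * hd2
    have hpos : 0 < ((d₁ + d₂) ^ 2 - (2 * L) ^ 2) * ((2 * L) ^ 2 - (d₁ - d₂) ^ 2) :=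
      mul_pos (by linarith) (by linarith)
    have hQ' : ((d₁ + d₂) ^ 2 - (2 * L) ^ 2) *
        ((d₁ + d₂) ^ 2 + (d₁ - d₂) ^ 2 - (4 * x ^ 2 + 4 * y ^ 2 + 16)) = 0 :=
      mul_eq_zero_of_right _ (by linarith)
    have key : 16 * (x ^ 2 * (L ^ 2 - 4) + L ^ 2 * y ^ 2 - L ^ 2 * (L ^ 2 - 4)) =
        (4 * x ^ 2 * ((d₁ + d₂) ^ 2 - 16) + 4 * y ^ 2 * (d₁ + d₂) ^ 2 -
          (d₁ + d₂) ^ 2 * ((d₁ + d₂) ^ 2 - 16)) +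
        ((d₁ + d₂) ^ 2 - (2 * L) ^ 2) * ((2 * L) ^ 2 - (d₁ - d₂) ^ 2) +
        ((d₁ + d₂) ^ 2 - (2 * L) ^ 2) *
          ((d₁ + d₂) ^ 2 + (d₁ - d₂) ^ 2 - (4 * x ^ 2 + 4 * y ^ 2 + 16)) := by
      ring
    nlinarith [key, hGS, hpos, hQ']

/-- **The axis form of the confocal ellipses with foci `±2`.** For `L > 2`, `M > 0` with
`M² = L² - 4`: `‖u - 2‖ + ‖u + 2‖ ≤ 2L ↔ (re u / L)² + (im u / M)² ≤ 1`, i.e. the ellipse with foci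
`±2` and focal sum `2L` has semi-axes `L` and `√(L² - 4)`. [folklore] -/
theorem focalSum_le_iff_axis {u : ℂ} {L M : ℝ} (hL : 2 < L) (hM : 0 < M)
    (hLM : M ^ 2 = L ^ 2 - 4) :
    focalSum u ≤ 2 * L ↔ (u.re / L) ^ 2 + (u.im / M) ^ 2 ≤ 1 := by
  have hL0 : 0 < L := by linarith
  rw [focalSum, div_pow, div_pow, div_add_div _ _ (pow_ne_zero 2 hL0.ne') (pow_ne_zero 2 hM.ne'),
    div_le_one (mul_pos (pow_pos hL0 2) (pow_pos hM 2)), hLM]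
  have hdd : (‖u + 2‖ - ‖u - 2‖) ^ 2 ≤ 16 := by
    have h := abs_norm_sub_norm_le (u + 2) (u - 2)
    rw [show u + 2 - (u - 2) = (4 : ℂ) by ring] at h
    have h4 : ‖(4 : ℂ)‖ = 4 := by norm_num
    rw [h4] at h
    obtain ⟨h₁, h₂⟩ := abs_le.1 h
    nlinarith [h₁, h₂]
  exact axis_core (norm_nonneg _) (norm_nonneg _) (norm_add_two_sq u) (norm_sub_two_sq u) hdd hL

/-- `re (toNorm z) = (re z - c) / h`. [folklore] -/
theorem toNorm_re' (a b : ℝ) (z : ℂ) : (toNorm a b z).re = (z.re - ellC a b) / ellH a b := by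
  rw [toNorm, Complex.div_ofReal_re, Complex.sub_re, Complex.ofReal_re]

/-- **(i) The axis form of the half-ellipse hull.** For `a < b`, `0 < ρ < 1`:
`B(a,b;ρ) = {z | 0 ≤ im z, ((re z - c)/(h(ρ + ρ⁻¹)))² + (im z/(h(ρ⁻¹ - ρ)))² ≤ 1}` — the closed
upper half of the ellipse with centre `c = (a+b)/2`, foci `a, b = c ∓ 2h`, semi-axes
`A = h(ρ + ρ⁻¹)` (sum of the focal distances `2A = (b-a)(ρ + ρ⁻¹)/2`, `mem_ellRegion_iff`) and
`B = h(ρ⁻¹ - ρ)` (`B² = A² - 4h²`). (The hypothesis `a < b` of the stub is not needed: both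
sides are defined by the same normalised coordinates `toNorm a b`.) [folklore] -/
theorem ellHull_eq_axis (a b : ℝ) {ρ : ℝ} (h0 : 0 < ρ) (h1 : ρ < 1) :
    ellHull a b ρ = {z : ℂ | 0 ≤ z.im ∧
        ((z.re - ellC a b) / (ellH a b * (ρ + ρ⁻¹))) ^ 2 +
          (z.im / (ellH a b * (ρ⁻¹ - ρ))) ^ 2 ≤ 1} := by
  have hL : 2 < ρ + ρ⁻¹ := two_lt_jLevel h0 h1
  have hM : 0 < ρ⁻¹ - ρ := by
    have := (one_lt_inv₀ h0).2 h1
    linarith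
  have hLM : (ρ⁻¹ - ρ) ^ 2 = (ρ + ρ⁻¹) ^ 2 - 4 := by
    have hρ : ρ * ρ⁻¹ = 1 := mul_inv_cancel₀ h0.ne'
    linear_combination (-4) * hρ
  ext z
  simp only [ellHull, ellRegion, mem_inter_iff, mem_setOf_eq, mem_jEllipse_iff]
  rw [jLevel, focalSum_le_iff_axis hL hM hLM, toNorm_re', toNorm_im, div_div, div_div]
  exact and_comm

/-! ### 2. Confocal room between two hulls of the family -/

/-- **(ii) Confocal room.** For `a < b` and `0 < r < ρ ≤ 1` the larger hull `B(a,b;r)` contains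
the `θ`-neighbourhood of `B(a,b;ρ)` within `ℍ̄`, `θ = h((r + r⁻¹) - (ρ + ρ⁻¹)) > 0`
(`jLevel_lt_jLevel`): the normalised focal sum is `2`-Lipschitz (`focalSum_le_add`) and `toNorm`
scales distances by `h⁻¹` (`dist_toNorm`). [folklore] -/
theorem exists_thickening_ellHull_subset {a b r ρ : ℝ} (hab : a < b) (hr : 0 < r) (hrρ : r < ρ)
    (hρ1 : ρ ≤ 1) :
    ∃ θ : ℝ, 0 < θ ∧
      Metric.thickening θ (ellHull a b ρ) ∩ closure UpperHalfPlane.upperHalfPlaneSet ⊆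
        ellHull a b r := by
  have hh := ellH_pos hab
  have hJ : jLevel ρ < jLevel r := jLevel_lt_jLevel hr hrρ hρ1
  refine ⟨ellH a b * (jLevel r - jLevel ρ), mul_pos hh (sub_pos.2 hJ), ?_⟩
  rintro z ⟨hz, hzc⟩
  obtain ⟨w, hw, hzw⟩ := Metric.mem_thickening_iff.1 hz
  have hw1 : focalSum (toNorm a b w) ≤ 2 * jLevel ρ := hw.1
  refine Set.mem_inter ?_ (closure_lt_subset_le continuous_const Complex.continuous_im hzc)
  show focalSum (toNorm a b z) ≤ 2 * jLevel r
  have h1 := focalSum_le_add (toNorm a b z) (toNorm a b w)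
  have h3 : ‖toNorm a b z - toNorm a b w‖ < jLevel r - jLevel ρ := by
    rw [← dist_eq_norm, dist_toNorm hab, div_lt_iff₀ hh]
    linarith
  linarith

/-! ### 3. The strict bound `Φ_B'(0) < 1` -/

/-- **(iii) `Φ_B'(0) < 1` strictly** for `a < b`, `0 < ρ < 1` under the positivity condition
`h(ρ + ρ⁻¹) < c`: with `v₀ = ellNode a b ∈ (-ρ, 0)` (`ellNode_data`),
`Φ_B'(0) = (1 - v₀²/ρ²)/(1 - v₀²) < 1` because `v₀² < v₀²/ρ²` (`v₀ ≠ 0`, `ρ < 1`). [folklore] -/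
theorem ellDeriv_lt_one {a b ρ : ℝ} (hab : a < b) (h0 : 0 < ρ) (h1 : ρ < 1)
    (hB : ellH a b * jLevel ρ < ellC a b) : ellDeriv a b ρ < 1 := by
  obtain ⟨hvρ, hv0, -, -⟩ := ellNode_data hab h0 h1.le hB
  set v := ellNode a b
  have hv2 : v ^ 2 < ρ ^ 2 := by nlinarith
  have hden : 0 < 1 - v ^ 2 := by nlinarith
  have hvv : 0 < v ^ 2 := by nlinarith
  have hρ2 : ρ ^ 2 < 1 := by nlinarith
  rw [ellDeriv, div_lt_one hden, sub_lt_sub_iff_left, lt_div_iff₀ (pow_pos h0 2)]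
  nlinarith [mul_lt_mul_of_pos_left hρ2 hvv]

/-! ### 4. The flattening limit -/

/-- Continuity of `t ↦ (1 - N(t)²/r(t)²)/(1 - N(t)²)` at a point where `r ≠ 0` and `N² ≠ 1`.
[folklore] -/
theorem continuousAt_derivFormula {N r : ℝ → ℝ} {x : ℝ} (hN : ContinuousAt N x)
    (hr : ContinuousAt r x) (hr2 : r x ^ 2 ≠ 0) (hN2 : 1 - N x ^ 2 ≠ 0) :
    ContinuousAt (fun t => (1 - N t ^ 2 / r t ^ 2) / (1 - N t ^ 2)) x := by
  fun_prop (disch := assumption)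

/-- **The node depends continuously on the foci**: if `f, g` are continuous at `x` with
`0 < f x < g x`, then `t ↦ ellNode (f t) (g t) = re J⁻¹(toNorm (f t) (g t) 0)` is continuous at `x`
(`toNorm a b 0 = -(a + b)/2 / ((b - a)/4)` is continuous in `(a, b)`, and the inverse branch `J⁻¹`
is holomorphic on the open set `W ∋ toNorm (f x) (g x) 0`, `differentiableAt_jInv`,
`ellNode_spec`). [folklore] -/
theorem continuousAt_ellNode_comp {f g : ℝ → ℝ} {x : ℝ} (hf : ContinuousAt f x)
    (hg : ContinuousAt g x) (hfg : f x < g x) (hpos : 0 < f x) :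
    ContinuousAt (fun t => ellNode (f t) (g t)) x := by
  obtain ⟨-, -, hW, -⟩ := ellNode_spec hfg hpos
  have hT : ContinuousAt (fun t => toNorm (f t) (g t) 0) x := by
    simp only [toNorm, ellC, ellH]
    refine ContinuousAt.div₀ (by fun_prop) (by fun_prop) ?_
    exact Complex.ofReal_ne_zero.2 (div_ne_zero (sub_ne_zero.2 hfg.ne') four_ne_zero)
  have hJ : ContinuousAt jInv (toNorm (f x) (g x) 0) := (differentiableAt_jInv hW).continuousAt
  exact Complex.continuous_re.continuousAt.comp (hJ.comp_of_eq hT rfl)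

/-- **`Φ'(0)` depends continuously on (foci, parameter)**: for `f, g, r` continuous at `x` with
`0 < f x < g x` and `r x ≠ 0`, `t ↦ ellDeriv (f t) (g t) (r t)` is continuous at `x` (the node is
in `(-1, 0)`, so the denominator `1 - v₀²` does not vanish). [folklore] -/
theorem continuousAt_ellDeriv_comp {f g r : ℝ → ℝ} {x : ℝ} (hf : ContinuousAt f x)
    (hg : ContinuousAt g x) (hr : ContinuousAt r x) (hfg : f x < g x) (hpos : 0 < f x)
    (hr0 : r x ≠ 0) :
    ContinuousAt (fun t => ellDeriv (f t) (g t) (r t)) x := by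
  obtain ⟨hv1, hv0, -, -⟩ := ellNode_spec hfg hpos
  have hN2 : 1 - ellNode (f x) (g x) ^ 2 ≠ 0 := by nlinarith
  exact continuousAt_derivFormula (continuousAt_ellNode_comp hf hg hfg hpos) hr
    (pow_ne_zero 2 hr0) hN2

/-- **(iv) The flattening limit.** For `0 < α < 1`, the half-ellipse hulls centred at `1` with
horizontal semi-axis `α` and vertical semi-axis `β → 0⁺` — foci `1 ∓ √(α² - β²)`, parameter
`ρ(β) = √((α - β)/(α + β))` — have `Φ'(0) → 1`: the expression is continuous in `β` at `0`
(`continuousAt_ellDeriv_comp`), where the foci are `1 ∓ α`, `ρ(0) = 1` and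
`ellDeriv (1 - α) (1 + α) 1 = 1` (`ellDeriv_one`). [folklore] -/
theorem tendsto_ellDeriv_flattening {α : ℝ} (hα0 : 0 < α) (hα1 : α < 1) :
    Tendsto (fun β : ℝ => ellDeriv (1 - Real.sqrt (α ^ 2 - β ^ 2))
        (1 + Real.sqrt (α ^ 2 - β ^ 2)) (Real.sqrt ((α - β) / (α + β))))
      (𝓝[>] 0) (𝓝 1) := by
  have hab : 1 - α < 1 + α := by linarith
  have ha : 0 < 1 - α := by linarith
  have hF0 : Real.sqrt (α ^ 2 - (0 : ℝ) ^ 2) = α := by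
    rw [zero_pow two_ne_zero, sub_zero, Real.sqrt_sq hα0.le]
  have hR0 : Real.sqrt ((α - 0) / (α + 0)) = 1 := by
    rw [sub_zero, add_zero, div_self hα0.ne', Real.sqrt_one]
  have hc : ContinuousAt (fun β : ℝ => ellDeriv (1 - Real.sqrt (α ^ 2 - β ^ 2))
      (1 + Real.sqrt (α ^ 2 - β ^ 2)) (Real.sqrt ((α - β) / (α + β)))) 0 := by
    refine continuousAt_ellDeriv_comp (by fun_prop) (by fun_prop) ?_ ?_ ?_ ?_
    · exact Real.continuous_sqrt.continuousAt.comp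
        (ContinuousAt.div₀ (by fun_prop) (by fun_prop) (by rw [add_zero]; exact hα0.ne'))
    · rw [hF0]
      linarith
    · rw [hF0]
      linarith
    · rw [hR0]
      exact one_ne_zero
  refine tendsto_nhdsWithin_of_tendsto_nhds ?_
  convert hc.tendsto using 2
  simp only [hF0, hR0, ellDeriv_one hab ha]

/-! ### The registered stub -/

/-- Stub 4b of line `pin-the-shear` (crux stmt-CriticalPhenomena-14221). **The half-ellipse hull
family** `ellHull a b ρ` (`EllipseHulls.lean`): (i) axis form — `ellHull a b ρ` is the closed
upper half of the ellipse with centre `c`, horizontal semi-axis `h(ρ + ρ⁻¹)` and vertical semi-axis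
`h(ρ⁻¹ - ρ)`, `c = ellC a b`, `h = ellH a b`; (ii) confocal room — a smaller parameter `r < ρ`
gives a hull containing a uniform `ℍ̄`-neighbourhood of `ellHull a b ρ`; (iii) `Φ'_B(0) < 1`
strictly (under the positivity condition `h(ρ + ρ⁻¹) < c`); (iv) flattening — for the hulls
centred at `1` with fixed horizontal semi-axis `α ∈ (0, 1)` and vertical semi-axis `β → 0⁺` (foci
`1 ∓ √(α² - β²)`, parameter `√((α - β)/(α + β))`), `Φ'(0) → 1`. [folklore] -/
theorem stub_ellipseHullFamily :
    (∀ (a b ρ : ℝ), a < b → 0 < ρ → ρ < 1 →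
      ellHull a b ρ = {z : ℂ | 0 ≤ z.im ∧
        ((z.re - ellC a b) / (ellH a b * (ρ + ρ⁻¹))) ^ 2 +
          (z.im / (ellH a b * (ρ⁻¹ - ρ))) ^ 2 ≤ 1}) ∧
    (∀ (a b r ρ : ℝ), a < b → 0 < r → r < ρ → ρ ≤ 1 →
      ∃ θ : ℝ, 0 < θ ∧
        Metric.thickening θ (ellHull a b ρ) ∩ closure UpperHalfPlane.upperHalfPlaneSet ⊆
          ellHull a b r) ∧
    (∀ (a b ρ : ℝ), a < b → 0 < ρ → ρ < 1 → ellH a b * jLevel ρ < ellC a b →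
      ellDeriv a b ρ < 1) ∧
    (∀ α : ℝ, 0 < α → α < 1 →
      Tendsto (fun β : ℝ => ellDeriv (1 - Real.sqrt (α ^ 2 - β ^ 2))
          (1 + Real.sqrt (α ^ 2 - β ^ 2)) (Real.sqrt ((α - β) / (α + β))))
        (𝓝[>] 0) (𝓝 1)) :=
  ⟨fun a b _ _ h0 h1 => ellHull_eq_axis a b h0 h1,
    fun _ _ _ _ hab hr hrρ hρ1 => exists_thickening_ellHull_subset hab hr hrρ hρ1,
    fun _ _ _ hab h0 h1 hB => ellDeriv_lt_one hab h0 h1 hB,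
    fun _ hα0 hα1 => tendsto_ellDeriv_flattening hα0 hα1⟩

end Summit.CriticalPhenomena.SAWScalingLimit.Cruxes.HexTransfer.PinTheShear
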